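import Summits.KontsevichZagierPeriods.KontsevichZagierPeriods.Theses.IsogenyCertificates
import Summits.KontsevichZagierPeriods.KontsevichZagierPeriods.Theorems.IsogenyCertificatesXMapKernelCellsUnconditional
import Summits.KontsevichZagierPeriods.KontsevichZagierPeriods.Theorems.IsogenyCertificatesXMapKernelIffSummit
import Summits.KontsevichZagierPeriods.KontsevichZagierPeriods.Theorems.HurwitzMicroSectorsNormalFormPrincipleDimOneAssembly
import Literature.NumberTheory.Transcendental.KZKernelConjectureForms

/-!
# F3 witness — `LogPeriodCell` at the floor parameter `θ₀ = ∅` is a theorem of the tree BY INSTANTIATION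

`MixedCell ∅` (the rung family at `T = ∅`) is, after `Set.union_empty`, literally the landed real-period cell
`Summit.KontsevichZagierPeriods.IsogenyCertificates.XMapKernelCells.realPeriodCellKernel_relations`
(`Theorems/IsogenyCertificatesXMapKernelCellsUnconditional.lean`, p119755 lineage). One `simpa`.
-/

namespace Summit.KontsevichZagierPeriods.KontsevichZagierPeriods.Cruxes.XMapKernel.LogPeriodCell

open scoped BigOperators
open Literature.NumberTheory.Transcendental
open Summit.KontsevichZagierPeriods.KontsevichZagierPeriods.Theses.IsogenyCertificates
open Summit.KontsevichZagierPeriods.IsogenyCertificates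
open Summit.KontsevichZagierPeriods.IsogenyCertificates.XMapKernelStubs

/-- Generators of the real-period sector (cell (i)), verbatim the set of `XMapKernelCells.realPeriodCellKernel_relations`. -/
def realPeriodGens : Set KZ.FormalRep :=
  {d : KZ.FormalRep | ∃ (A B : ℤ) (a : ℚ) (r : KZ.IntegralRep 1), 4 * A ^ 3 + 27 * B ^ 2 ≠ 0 ∧
    r.domain = {x | 0 < x 0 ^ 3 + (A : ℝ) * x 0 + (B : ℝ)} ∧
    Set.EqOn r.integrand (fun x => (a : ℝ) / Real.sqrt (x 0 ^ 3 + (A : ℝ) * x 0 + (B : ℝ))) r.domain ∧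
    d = KZ.of r}

/-- Classes of KZ-rational integral representations of dimension `≤ d`. -/
def ratGensLE (d : ℕ) : Set KZ.FormalRep :=
  {c : KZ.FormalRep | ∃ (n : ℕ) (r : KZ.IntegralRep n), n ≤ d ∧ r.IsRational ∧ c = KZ.of r}

/-- The ladder family. -/
def MixedCell (T : Set KZ.FormalRep) : Prop :=
  ∀ c ∈ AddSubgroup.closure (realPeriodGens ∪ T), KZ.eval c = 0 → c ∈ KZ.relations

/-- **The rung** `LogPeriodCell := MixedCell (ratGensLE 1)`. -/
def LogPeriodCell : Prop := MixedCell (ratGensLE 1)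


/-- **Special value (F3)**: the rung family at the floor parameter is the landed floor theorem. -/
example : MixedCell ∅ := by
  simpa [MixedCell, realPeriodGens] using XMapKernelCells.realPeriodCellKernel_relations

/-- The same, by `intro`/`exact` (no simp normal-form risk). -/
example : MixedCell ∅ := by
  intro c hc hc0
  simp only [Set.union_empty] at hc
  exact XMapKernelCells.realPeriodCellKernel_relations c hc hc0

end Summit.KontsevichZagierPeriods.KontsevichZagierPeriods.Cruxes.XMapKernel.LogPeriodCell
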